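import Summits.ABC.IUTFork.Cor312HullGluedDHVol
import HarnessLib

/-!
# [IUTchIII] Cor. 3.12 — the hull-glued setting AT THE SETTING OF RECORD, globally: `HullDefined` and
# `ThetaFinite` for `P♮` OUTRIGHT, `BridgeHyps P♮`, and the typed Statement of `P` IMPLIES that of `P♮`

PROOF-ONLY sequel (abc-iut cell, seat abc-iut-w5-d060, WAVE-5) of p425664 `Cor312HullGluedDHVol` / p424693
`Cor312HullGluedStable`. TAKES NO SIDE on [IUTchIII] Cor. 3.12; no definition, no `Prop` fact.

`P♮ := P.hullGlued` glues the Θ-side at EVERY packet by print's own object `^{n,∘}𝒰_{j,v_ℚ} = P.thetaHull j vQ` (the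
pinned reading (pΘ) of the PINNED-REGIONS round). p425664 showed: at abc-iut-c312-5's assembled DH-level real setting
`Real.settingDHVol(Sharp)` the hull-gluing changes the local Θ-volume at only finitely many packets. THIS FILE adds
the direction that needs NO stability hypothesis at all:

* §1 (any setting `P`): `thetaHull_subset_hullGlued_thetaHull` (`^{n,∘}𝒰 ⊆ ^{n,∘}𝒰♮`: the hull only grows);
  `thetaLocal_le_hullGlued_thetaLocal` (monotone log-volume ⇒ local Θ-volume of `P` ≤ that of `P♮`);
  `hullGlued_thetaFinite_of_agree_off_finite` (`ThetaFinite P♮` from `ThetaFinite P`, `HullDefined P♮` at the label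
  packets, and agreement of the local Θ-volumes off a finite set); **`hullGlued_statement_of_mono`** (`LogvolMono P`,
  `ThetaFinite P♮` ⇒ (`P.Statement → P♮.Statement`)).
* §2 at `Real.settingDHVol`: **`hullGlued_hullDefined_settingDHVol`** — `P♮.HullDefined` at EVERY packet where
  `P.HullDefined` (the (Ind1)/(Ind2)-orbit of `^{n,∘}𝒰` is absorbed by a log-shell lattice `e⁻¹(Π_{v⃗} c·I_{v⃗})`,
  abc-iut-c312-5's mechanism of `hullDefined_settingDHVol_inr`, Dupuy–Hilado §4.10).
* §3 at `Real.settingDHVolSharp` (pilot regions read off ideles; only the idele binders `ht0/ht1/htq0/htq1`):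
  **`hullGlued_thetaFinite_settingDHVolSharp`** (`−|log(Θ)|♮ ∈ ℝ`), **`bridgeHyps_hullGlued_settingDHVolSharp`**
  (c312-6's `BridgeHyps` for `P♮`, every field a theorem, via c312-5's generic `bridgeHyps_DH`), and
  **`hullGlued_statement_settingDHVolSharp_of_statement`**: the typed Corollary 3.12 for the setting of record
  IMPLIES the typed Corollary 3.12 for its hull-gluing.

Reading (neutral): at the setting ADJUDICATION-SPEC §1 names, the «pinned-hull» setting `P♮` satisfies every typed
side condition BY THEOREM, and its Statement is AT MOST AS STRONG as the typed one (equal off finitely many packets,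
p425664; possibly weaker at the rest under (Ind2)_DH, p425317). Nothing here asserts either Statement.
[claim: Mochizuki2012, status: disputed] vocabulary only. [cite: DupuyHilado2025, §3.9, §4.10]
-/

noncomputable section

open Set Function

/-! ## 1. Any setting: the hull only grows; monotone volumes; `ThetaFinite` and the Statement for `P♮` -/

namespace Summit.ABC.IUTFork.Cor312.Setting

open Thm311 Literature.IUT.LogThetaLattice

variable {T : ThetaIndex} {S : Situation T} (P : Setting S)

/-- **`^{n,∘}𝒰 ⊆ ^{n,∘}𝒰♮`**: the packet hull of `P` is one of the possible images of `P♮` (identity indeterminacy),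
so it lies in their hull. No hypothesis. [claim: Mochizuki2012, status: disputed] -/
theorem thetaHull_subset_hullGlued_thetaHull (j : T.Label) (vQ : T.VQ) :
    P.thetaHull j vQ ⊆ P.hullGlued.thetaHull j vQ := by
  show P.thetaHull j vQ ⊆ (P.frame j vQ).hull (⋃₀ P.hullGlued.possibleImages j vQ)
  refine Set.Subset.trans (fun x hx => ?_) ((P.frame j vQ).subset_hull _)
  refine Set.mem_sUnion.2 ⟨_, P.hullGlued.thetaRegion3_mem_possibleImages j vQ, ?_⟩
  rw [hullGlued_thetaRegion3]
  exact hx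

/-- If `P.HullDefined` then `⋃₀ P.possibleImages ⊆ ^{n,∘}𝒰 ⊆ ⋃₀ P♮.possibleImages`. [folklore] -/
theorem sUnion_possibleImages_subset_hullGlued (j : T.Label) (vQ : T.VQ) :
    ⋃₀ P.possibleImages j vQ ⊆ ⋃₀ P.hullGlued.possibleImages j vQ := fun x hx =>
  Set.mem_sUnion.2 ⟨_, P.hullGlued.thetaRegion3_mem_possibleImages j vQ, by
    rw [hullGlued_thetaRegion3]; exact (P.frame j vQ).subset_hull _ hx⟩

/-- **`ThetaFinite P♮` from agreement off a finite set**: if `P` is Θ-finite, `P♮` has `HullDefined` at every label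
packet, and at each label the local Θ-volumes of `P♮` and `P` agree outside a finite set of places, then `P♮` is
Θ-finite. [claim: Mochizuki2012, status: disputed] -/
theorem hullGlued_thetaFinite_of_agree_off_finite (hfin : P.ThetaFinite)
    (hdef' : ∀ (i : Fin T.lstar) (vQ : T.VQ), P.hullGlued.HullDefined (labelSucc i) vQ)
    (E : Fin T.lstar → Set T.VQ) (hE : ∀ i, (E i).Finite)
    (hagree : ∀ (i : Fin T.lstar) (vQ : T.VQ), vQ ∉ E i →
      P.hullGlued.thetaLocal (labelSucc i) vQ = P.thetaLocal (labelSucc i) vQ) :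
    P.hullGlued.ThetaFinite := by
  refine ⟨fun i vQ => ?_, fun i => ?_⟩
  · unfold thetaLocal
    rw [if_pos (hdef' i vQ)]
    exact WithTop.coe_ne_top
  · refine ((hE i).union (hfin.2 i)).subset fun vQ hvQ => ?_
    by_cases hmem : vQ ∈ E i
    · exact Or.inl hmem
    · right
      rw [Function.mem_support] at hvQ ⊢
      rwa [hagree i vQ hmem] at hvQ

end Summit.ABC.IUTFork.Cor312.Setting

namespace Summit.ABC.IUTFork.Cor312Vol

open Thm311 Cor312 Cor312.Setting Literature.IUT.LogThetaLattice

variable {T : ThetaIndex} {S : Situation T} {P : Cor312.Setting S}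

/-- **Monotone volumes: the local Θ-volume of `P` is at most that of `P♮`** (where both hulls are defined).
[claim: Mochizuki2012, status: disputed] -/
theorem thetaLocal_le_hullGlued_thetaLocal (hmono : LogvolMono P) (i : Fin T.lstar) (vQ : T.VQ)
    (hdef : P.HullDefined (labelSucc i) vQ) (hdef' : P.hullGlued.HullDefined (labelSucc i) vQ) :
    P.thetaLocal (labelSucc i) vQ ≤ P.hullGlued.thetaLocal (labelSucc i) vQ := by
  unfold Setting.thetaLocal
  rw [if_pos hdef, if_pos hdef']
  exact WithTop.coe_le_coe.2
    (hmono i vQ (P.thetaHull_adm hdef) (P.hullGlued.thetaHull_adm hdef') (P.thetaHull_subset_hullGlued_thetaHull _ vQ))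

/-- **The typed Statement of `P` IMPLIES that of `P♮`** (monotone log-volume and `ThetaFinite P♮`; no stability
hypothesis): `−|log(q)| ≤ −|log(Θ)| ≤ −|log(Θ)|♮`. [claim: Mochizuki2012, status: disputed] -/
theorem hullGlued_statement_of_mono (hmono : LogvolMono P) (hfin' : P.hullGlued.ThetaFinite) (h : P.Statement) :
    P.hullGlued.Statement := by
  have hfin : P.ThetaFinite := by
    by_contra hf
    exact h.1 (by unfold Setting.negLogTheta; rw [if_neg hf])
  have hdef : ∀ (i : Fin T.lstar) (vQ : T.VQ), P.HullDefined (labelSucc i) vQ := fun i vQ => by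
    by_contra hd
    exact hfin.1 i vQ (by unfold Setting.thetaLocal; rw [if_neg hd])
  have hdef' : ∀ (i : Fin T.lstar) (vQ : T.VQ), P.hullGlued.HullDefined (labelSucc i) vQ := fun i vQ => by
    by_contra hd
    exact hfin'.1 i vQ (by unfold Setting.thetaLocal; rw [if_neg hd])
  have hloc : ∀ (i : Fin T.lstar) (vQ : T.VQ),
      (P.thetaLocal (labelSucc i) vQ).untopD 0 ≤ (P.hullGlued.thetaLocal (labelSucc i) vQ).untopD 0 := by
    intro i vQ
    have hle := hmono i vQ (P.thetaHull_adm (hdef i vQ)) (P.hullGlued.thetaHull_adm (hdef' i vQ))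
      (P.thetaHull_subset_hullGlued_thetaHull _ vQ)
    unfold Setting.thetaLocal
    rw [if_pos (hdef i vQ), if_pos (hdef' i vQ), WithTop.untopD_coe, WithTop.untopD_coe]
    exact hle
  have h2 := h.2
  unfold Setting.Statement
  unfold Setting.negLogTheta at h2 ⊢
  rw [if_pos hfin] at h2
  rw [if_pos hfin', P.hullGlued_negLogQ]
  refine ⟨WithTop.coe_ne_top, h2.trans (WithTop.coe_le_coe.2 (processionNormalized_mono fun i => ?_))⟩
  exact finsum_le_finsum' (hfin.2 i) (hfin'.2 i) fun vQ => hloc i vQ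

end Summit.ABC.IUTFork.Cor312Vol

/-! ## 2. At `Real.settingDHVol`: `HullDefined` for `P♮` at every packet -/

namespace Summit.ABC

namespace IUTFork

namespace Thm311

namespace Real

open Cor312 Cor312.Setting Cor312Vol Literature.IUT.LogThetaLattice Literature.IUT.LogVolume

variable {F : Type} [Field F] [NumberField F] (X : PilotData F) {logv : PadicLogs F} (hlog : LogvAnalytic logv)

section Setting

variable (M : Type) [Field M] [NumberField M]
  (archPk : ∀ (j : (thetaIndex X).Label) (vQ : (thetaIndex X).VQ), Set ((logShellsDH X logv).Packet j vQ))
  (archSub : ∀ (j : (thetaIndex X).Label) (v : (thetaIndex X).V),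
    Set ((logShellsDH X logv).Packet j ((thetaIndex X).over v)))
  (Ψ : ℤ → ∀ v : (thetaIndex X).V, v ∈ (thetaIndex X).Vbad → Set ((logShellsDH X logv).StarPacket v))
  (act : ℤ → ∀ v : (thetaIndex X).V, v ∈ (thetaIndex X).Vbad →
    (logShellsDH X logv).StarPacket v → Module.End ℚ ((logShellsDH X logv).StarPacket v))
  (Mmod : ℤ → ∀ j : (thetaIndex X).LabelStar, Set ((logShellsDH X logv).GlobalPacket j.1))
  (region : ℤ → ∀ j : (thetaIndex X).LabelStar, FinDivisor M → ∀ vQ : (thetaIndex X).VQ,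
    Set ((logShellsDH X logv).Packet j.1 vQ))
  (n : ℤ) {HT : Type} {LogLink : HT → HT → Type} {IsFull : ∀ {s t : HT}, LogLink s t → Prop}
  (lat : LGPGaussianLogThetaLattice LogLink IsFull)
  {Frd : Type} {IsoF : Frd → Frd → Type} {Ob : Frd → Type} {realify : Frd → Frd} {Strip : Type}
  {IsoS : Strip → Strip → Type} {Mv : ∀ v : (thetaIndex X).V, v ∈ (thetaIndex X).Vbad → Type}
  [∀ v h, Monoid (Mv v h)]
  (sig : GlobalLGPFrobenioidSignature (thetaIndex X).lstar (thetaIndex X).V (· ∈ (thetaIndex X).Vbad)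
    Frd IsoF Ob realify Strip IsoS Mv)
  (split : SplittingMonoids Mv) {ObΔ : Type} {N : ∀ v : (thetaIndex X).V, v ∈ (thetaIndex X).Vbad → Type}
  [∀ v h, Monoid (N v h)] (qData : QPilotData ObΔ N)
  (thetaBox : ℤ → Ob sig.Clgp → ∀ (j : (thetaIndex X).Label) (vQ : (thetaIndex X).VQ),
    Set (∀ s : factorIdxDH X hlog j vQ, factorFieldDH X hlog j vQ s))
  (qCentre : ObΔ → ∀ (j : (thetaIndex X).Label) (vQ : (thetaIndex X).VQ),
    ∀ s : factorIdxDH X hlog j vQ, factorFieldDH X hlog j vQ s)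
  (hq : ∀ j vQ s, qCentre (qPilotObject qData) j vQ s ≠ 0)
  (hfin : ∀ j : (thetaIndex X).Label, (Function.support fun vQ =>
    ((situationDHVol X hlog M archPk archSub Ψ act Mmod region).D n).logvol j vQ
      (factorMapDH X hlog j vQ ⁻¹' hullSet (factorFieldDH X hlog j vQ) (qCentre (qPilotObject qData) j vQ))).Finite)

/-- **`P♮.HullDefined` at `∞`**, unconditionally (empty field-factor index, as for `P`). [folklore] -/
theorem hullGlued_hullDefined_settingDHVol_inl (j : (thetaIndex X).Label) (u : Unit) :
    (settingDHVol X hlog M archPk archSub Ψ act Mmod region n lat sig split qData thetaBox qCentre hq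
      hfin).hullGlued.HullDefined j (.inl u) := by
  refine ⟨isBounded_iff_forall_norm_le.2 ⟨0, fun z _ => (pi_norm_le_iff_of_nonneg le_rfl).2 fun s => s.elim⟩,
    fun s => s.elim⟩

/-- **`P♮.HullDefined` at a prime wherever `P.HullDefined`**: the whole (Ind1)/(Ind2)-orbit of `^{n,∘}𝒰_{j,p}` is
absorbed by a log-shell lattice `e⁻¹(Π_{v⃗} c·I_{v⃗})` (bounded, stable under every (Ind1)/(Ind2) family:
abc-iut-c312-5 `exists_latticeF_of_norm_le`, `family_image_latticePk`; Dupuy–Hilado §4.10), and contains the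
nondegenerate image of `P`'s possible images. [cite: DupuyHilado2025, §4.10] -/
theorem hullGlued_hullDefined_settingDHVol_inr (j : (thetaIndex X).Label) (pp : Nat.Primes)
    (hdef : (settingDHVol X hlog M archPk archSub Ψ act Mmod region n lat sig split qData thetaBox qCentre hq
      hfin).HullDefined j (.inr pp)) :
    (settingDHVol X hlog M archPk archSub Ψ act Mmod region n lat sig split qData thetaBox qCentre hq
      hfin).hullGlued.HullDefined j (.inr pp) := by
  haveI : Fact (pp : ℕ).Prime := ⟨pp.2⟩
  set P := settingDHVol X hlog M archPk archSub Ψ act Mmod region n lat sig split qData thetaBox qCentre hq hfin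
    with hP
  -- `P.HullDefined` at the pulled-back real frame: bounded and nondegenerate image of `⋃₀ possibleImages`
  have hb : Bornology.IsBounded (factorMapDH X hlog j (.inr pp) '' ⋃₀ P.possibleImages j (.inr pp)) := hdef.1
  have hnd : IsNondegenerate (factorFieldDH X hlog j (.inr pp))
      (factorMapDH X hlog j (.inr pp) '' ⋃₀ P.possibleImages j (.inr pp)) := hdef.2
  -- `^{n,∘}𝒰 = e⁻¹(hull of the image)`, so its image is bounded
  have hhull : P.thetaHull j (.inr pp) = factorMapDH X hlog j (.inr pp) ⁻¹'
      (HullFrame.ofLocalFields (factorFieldDH X hlog j (.inr pp))).hull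
        (factorMapDH X hlog j (.inr pp) '' ⋃₀ P.possibleImages j (.inr pp)) :=
    HullFrame.comap_hull _ _ hb
  have hbU : Bornology.IsBounded (factorMapDH X hlog j (.inr pp) '' P.thetaHull j (.inr pp)) := by
    refine Bornology.IsBounded.subset
      ((HullFrame.ofLocalFields (factorFieldDH X hlog j (.inr pp))).hull_bounded hb) ?_
    rw [hhull]
    exact Set.image_preimage_subset _ _
  -- absorb it in a lattice `latticePk c`
  obtain ⟨R, hR⟩ := isBounded_iff_forall_norm_le.1 hbU
  obtain ⟨c, -, hcR⟩ := (presAt X hlog pp).exists_latticeF_of_norm_le (j := j) R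
  have hsub : P.thetaHull j (.inr pp) ⊆ (presAt X hlog pp).latticePk j c := by
    intro x hx
    rw [← (presAt X hlog pp).preimage_latticeF_comparison c]
    exact hcR (factorMapDH X hlog j (.inr pp) x) fun s =>
      (norm_le_pi_norm (factorMapDH X hlog j (.inr pp) x) s).trans (hR _ ⟨x, hx, rfl⟩)
  -- the orbit of `^{n,∘}𝒰` stays in the lattice
  have horb : ⋃₀ P.hullGlued.possibleImages j (.inr pp) ⊆ (presAt X hlog pp).latticePk j c :=
    P.hullGlued.sUnion_possibleImages_subset (fun Φ hΦ => (presAt X hlog pp).family_image_latticePk hΦ j c)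
      (by rw [hullGlued_thetaRegion3]; exact hsub)
  refine ⟨?_, ?_⟩
  · -- bounded: inside `e '' latticePk c = latticeF c`
    obtain ⟨R', hR'0, hR'⟩ := (presAt X hlog pp).exists_norm_le_of_mem_latticeF (j := j) c
    have himg : factorMapDH X hlog j (.inr pp) '' (presAt X hlog pp).latticePk j c =
        (presAt X hlog pp).latticeF j c :=
      (presAt X hlog pp).image_latticePk c
    refine isBounded_iff_forall_norm_le.2 ⟨R', fun z hz => (pi_norm_le_iff_of_nonneg hR'0).2 (hR' z ?_)⟩
    rw [← himg]
    exact Set.image_mono horb hz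
  · -- nondegenerate: contains the image of `P`'s possible images
    exact isNondegenerate_mono (Set.image_mono (P.sUnion_possibleImages_subset_hullGlued j (.inr pp))) hnd

/-- **`P♮.HullDefined` at EVERY packet where `P.HullDefined`** (at `∞` unconditionally). [claim: Mochizuki2012, status: disputed] -/
theorem hullGlued_hullDefined_settingDHVol (j : (thetaIndex X).Label) (vQ : (thetaIndex X).VQ)
    (hdef : (settingDHVol X hlog M archPk archSub Ψ act Mmod region n lat sig split qData thetaBox qCentre hq
      hfin).HullDefined j vQ) :
    (settingDHVol X hlog M archPk archSub Ψ act Mmod region n lat sig split qData thetaBox qCentre hq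
      hfin).hullGlued.HullDefined j vQ := by
  rcases vQ with u | pp
  · exact hullGlued_hullDefined_settingDHVol_inl X hlog M archPk archSub Ψ act Mmod region n lat sig split qData
      thetaBox qCentre hq hfin j u
  · exact hullGlued_hullDefined_settingDHVol_inr X hlog M archPk archSub Ψ act Mmod region n lat sig split qData
      thetaBox qCentre hq hfin j pp hdef

end Setting

/-! ## 3. At `Real.settingDHVolSharp`: `ThetaFinite P♮`, `BridgeHyps P♮`, and `Statement P → Statement P♮` -/

section Sharp

variable (t : ∀ (pp : Nat.Primes) (_ : Fin X.lstar) (x : (thetaIndex X).Fibre (.inr pp)),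
    haveI : Fact (pp : ℕ).Prime := ⟨pp.2⟩; kOf X pp.1 x)
  (tq : ∀ (pp : Nat.Primes) (x : (thetaIndex X).Fibre (.inr pp)),
    haveI : Fact (pp : ℕ).Prime := ⟨pp.2⟩; kOf X pp.1 x)
  (M : Type) [Field M] [NumberField M]
  (archPk : ∀ (j : (thetaIndex X).Label) (vQ : (thetaIndex X).VQ), Set ((logShellsDH X logv).Packet j vQ))
  (archSub : ∀ (j : (thetaIndex X).Label) (v : (thetaIndex X).V),
    Set ((logShellsDH X logv).Packet j ((thetaIndex X).over v)))
  (Ψ : ℤ → ∀ v : (thetaIndex X).V, v ∈ (thetaIndex X).Vbad → Set ((logShellsDH X logv).StarPacket v))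
  (act : ℤ → ∀ v : (thetaIndex X).V, v ∈ (thetaIndex X).Vbad →
    (logShellsDH X logv).StarPacket v → Module.End ℚ ((logShellsDH X logv).StarPacket v))
  (Mmod : ℤ → ∀ j : (thetaIndex X).LabelStar, Set ((logShellsDH X logv).GlobalPacket j.1))
  (region : ℤ → ∀ j : (thetaIndex X).LabelStar, FinDivisor M → ∀ vQ : (thetaIndex X).VQ,
    Set ((logShellsDH X logv).Packet j.1 vQ))
  (n : ℤ) {HT : Type} {LogLink : HT → HT → Type} {IsFull : ∀ {s t : HT}, LogLink s t → Prop}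
  (lat : LGPGaussianLogThetaLattice LogLink IsFull)
  {Frd : Type} {IsoF : Frd → Frd → Type} {Ob : Frd → Type} {realify : Frd → Frd} {Strip : Type}
  {IsoS : Strip → Strip → Type} {Mv : ∀ v : (thetaIndex X).V, v ∈ (thetaIndex X).Vbad → Type}
  [∀ v h, Monoid (Mv v h)]
  (sig : GlobalLGPFrobenioidSignature (thetaIndex X).lstar (thetaIndex X).V (· ∈ (thetaIndex X).Vbad)
    Frd IsoF Ob realify Strip IsoS Mv)
  (split : SplittingMonoids Mv) {ObΔ : Type} {N : ∀ v : (thetaIndex X).V, v ∈ (thetaIndex X).Vbad → Type}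
  [∀ v h, Monoid (N v h)] (qData : QPilotData ObΔ N)
  (ht0 : ∀ pp i x, t pp i x ≠ 0)
  (ht1 : ∀ (pp : Nat.Primes) (i : Fin X.lstar) (x : (thetaIndex X).Fibre (.inr pp)),
    haveI : Fact (pp : ℕ).Prime := ⟨pp.2⟩; placeOf X pp.1 x ∉ X.S → ‖t pp i x‖ = 1)
  (htq0 : ∀ pp x, tq pp x ≠ 0)
  (htq1 : ∀ (pp : Nat.Primes) (x : (thetaIndex X).Fibre (.inr pp)),
    haveI : Fact (pp : ℕ).Prime := ⟨pp.2⟩; placeOf X pp.1 x ∉ X.S → ‖tq pp x‖ = 1)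

include ht0 ht1

/-- **`−|log(Θ)|♮ ∈ ℝ` at the sharp setting of record**: `ThetaFinite` for the hull-glued setting, from
`ThetaFinite` for the setting (abc-iut-c312-3 `thetaFinite_settingDHVolSharp`), `HullDefined♮` everywhere (§2), and
agreement of the local Θ-volumes off a finite prime set (p425664). [claim: Mochizuki2012, status: disputed] -/
theorem hullGlued_thetaFinite_settingDHVolSharp :
    (settingDHVolSharp X hlog M archPk archSub Ψ act Mmod region n lat sig split qData tq t htq0
      htq1).hullGlued.ThetaFinite := by
  set P := settingDHVolSharp X hlog M archPk archSub Ψ act Mmod region n lat sig split qData tq t htq0 htq1 with hP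
  have hfin : P.ThetaFinite :=
    thetaFinite_settingDHVolSharp X hlog t tq M archPk archSub Ψ act Mmod region n lat sig split qData ht0 ht1 htq0 htq1
  have hdef : ∀ (i : Fin (thetaIndex X).lstar) (vQ : (thetaIndex X).VQ), P.HullDefined (Setting.labelSucc i) vQ :=
    fun i vQ => by
    by_contra hd
    exact hfin.1 i vQ (by unfold Setting.thetaLocal; rw [if_neg hd])
  refine P.hullGlued_thetaFinite_of_agree_off_finite hfin
    (fun i vQ => hullGlued_hullDefined_settingDHVol X hlog M archPk archSub Ψ act Mmod region n lat sig split qData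
      _ _ _ _ _ vQ (hdef i vQ))
    (fun i => Set.range Sum.inl ∪ Sum.inr '' {pp : Nat.Primes |
      P.hullGlued.thetaLocal (Setting.labelSucc i) (.inr pp) ≠ P.thetaLocal (Setting.labelSucc i) (.inr pp)})
    (fun i => (Set.finite_range _).union
      ((finite_hullGlued_thetaLocal_ne_settingDHVolSharp X hlog t tq M archPk archSub Ψ act Mmod region n lat sig
        split qData ht0 ht1 htq0 htq1 i).image _))
    (fun i vQ hvQ => ?_)
  rcases vQ with u | pp
  · exact absurd (Set.mem_union_left _ (Set.mem_range_self u)) hvQ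
  · by_contra hne
    exact hvQ (Set.mem_union_right _ ⟨pp, hne, rfl⟩)

include htq0 htq1 in
/-- **c312-6's `BridgeHyps` for the HULL-GLUED sharp setting of record — every field a theorem** (abc-iut-c312-5's
generic `bridgeHyps_DH`: the (Ind3)-region of `P♮` is the admissible hull-set `^{n,∘}𝒰`, its log-volume is `P`'s
local Θ-volume (finite support), hull-sets are nonempty, `ThetaFinite♮` above). [claim: Mochizuki2012, status: disputed] -/
theorem bridgeHyps_hullGlued_settingDHVolSharp :
    BridgeHyps (settingDHVolSharp X hlog M archPk archSub Ψ act Mmod region n lat sig split qData tq t htq0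
      htq1).hullGlued := by
  set P := settingDHVolSharp X hlog M archPk archSub Ψ act Mmod region n lat sig split qData tq t htq0 htq1 with hP
  have H : BridgeHyps P :=
    bridgeHyps_settingDHVolSharp_of_ideles X hlog t tq M archPk archSub Ψ act Mmod region n lat sig split qData ht0
      ht1 htq0 htq1
  refine bridgeHyps_DH X hlog M archPk archSub Ψ act Mmod region P.hullGlued (fun i vQ => ?_) (fun i => ?_)
    H.hul_nonempty
    (hullGlued_thetaFinite_settingDHVolSharp X hlog t tq M archPk archSub Ψ act Mmod region n lat sig split qData ht0
      ht1 htq0 htq1)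
  · rw [hullGlued_thetaRegion3]
    exact P.thetaHull_adm (hullDefined_of_finite H i vQ)
  · refine (H.finite.2 i).subset fun vQ hvQ => ?_
    rw [Function.mem_support] at hvQ ⊢
    rw [thetaLocal_untopD H i vQ]
    rw [hullGlued_thetaRegion3] at hvQ
    exact hvQ

include htq0 htq1 in
/-- **At the sharp setting of record, the typed Corollary 3.12 IMPLIES the typed Corollary 3.12 for its
hull-gluing** (`−|log(q)| ≤ −|log(Θ)| ≤ −|log(Θ)|♮`; monotone verbatim volumes, `ThetaFinite♮`). Neither Statement is
asserted. [claim: Mochizuki2012, status: disputed] -/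
theorem hullGlued_statement_settingDHVolSharp_of_statement
    (h : (settingDHVolSharp X hlog M archPk archSub Ψ act Mmod region n lat sig split qData tq t htq0 htq1).Statement) :
    (settingDHVolSharp X hlog M archPk archSub Ψ act Mmod region n lat sig split qData tq t htq0
      htq1).hullGlued.Statement :=
  hullGlued_statement_of_mono
    (bridgeHyps_settingDHVolSharp_of_ideles X hlog t tq M archPk archSub Ψ act Mmod region n lat sig split qData ht0
      ht1 htq0 htq1).mono
    (hullGlued_thetaFinite_settingDHVolSharp X hlog t tq M archPk archSub Ψ act Mmod region n lat sig split qData ht0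
      ht1 htq0 htq1) h

end Sharp

end Real

end Thm311

end IUTFork

end Summit.ABC

end
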